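import Mathlib.Algebra.MvPolynomial.PDeriv
import Mathlib.Algebra.CharP.Lemmas
import Mathlib.RingTheory.Ideal.Operations
import HarnessLib

/-!
# T⁽⁴⁾/7: THE ORIGIN OF `V(z² + (y²+x³)³ + w⁷ + v⁸ + x¹²) ⊂ 𝔸⁵` IS AN ISOLATED SINGULARITY IN CHARACTERISTIC `7` — the Jacobian at the primes
# strictly inside the origin (crux `FInjectiveMacaulayfication` stmt-ResolutionOfSingularities-15315, chain w45a; input H4 «isolated» of the germ-form
# row `T4GermChar7.t4_origin_germ_instance`; seat res-L1-w45a-stub-3 g8)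

[OURS · L1 W4.5a] Support file (`--supports stmt-ResolutionOfSingularities-15315 --as helper`); replaces the role of NO printed item; NOT a statement of
any manuscript; def-free, pure commutative algebra in `k[X₀,…,X₄]`. AI-written (AI review is weaker than expert review).

* §1 the five partial derivatives of `g = X₂² + (X₁² + X₀³)³ + X₃⁷ + X₄⁸ + X₀¹²` (any commutative ring): `∂₀ = 9X₀²(X₁²+X₀³)² + 12X₀¹¹`,
  `∂₁ = 6X₁(X₁²+X₀³)²`, `∂₂ = 2X₂`, `∂₃ = 7X₃⁶`, `∂₄ = 8X₄⁷`.
* §2 `exists_pderiv_not_mem` (`char k = 7`): for a prime `P ∋ g` all of whose members vanish at `0` and which misses some `Xᵢ`, some `∂ᵢg ∉ P`.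
  If all `∂ᵢ g ∈ P`: `X₂, X₄ ∈ P`; `X₁ ∈ P` or `u = X₁²+X₀³ ∈ P`; `u ∈ P` ⇒ (`∂₀`) `X₀ ∈ P` ⇒ `X₁ ∈ P` ⇒ (`g ∈ P`) `X₃ ∈ P`, so `P` is the origin;
  `X₁ ∈ P ∌ u` ⇒ `X₀ ∉ P` and `∂₀ − 9X₀²X₁²(X₁² + 2X₀³) = X₀⁸(9 + 12X₀³) ∈ P` ⇒ `9 + 12X₀³ ∈ P`, constant coefficient `9 = 2 ≠ 0` — contradiction.

[folklore; cite: Hartshorne1977, I Thm. 5.1 (Jacobian criterion)]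
-/

set_option linter.dupNamespace false

noncomputable section

namespace Summit.ResolutionOfSingularities.ResolutionOfSingularities.Theorems.FInjectiveMacaulayfication.T4GermJacobianChar7

open MvPolynomial
open Summit.ResolutionOfSingularities.ResolutionOfSingularities.Theorems.FInjectiveMacaulayfication

/-! ## §1 Partial derivatives of `g = X₂² + (X₁² + X₀³)³ + X₃⁷ + X₄⁸ + X₀¹²` -/

/-- `∂₀ g = 9X₀²(X₁² + X₀³)² + 12X₀¹¹`. [folklore] -/
theorem pderiv_zero_t4 {A : Type*} [CommRing A] :
    pderiv 0 (X 2 ^ 2 + (X 1 ^ 2 + X 0 ^ 3) ^ 3 + X 3 ^ 7 + X 4 ^ 8 + X 0 ^ 12 : MvPolynomial (Fin 5) A) =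
      9 * X 0 ^ 2 * (X 1 ^ 2 + X 0 ^ 3) ^ 2 + 12 * X 0 ^ 11 := by
  simp only [map_add, pderiv_pow, pderiv_X_self,
    pderiv_X_of_ne (show (1 : Fin 5) ≠ 0 by decide), pderiv_X_of_ne (show (2 : Fin 5) ≠ 0 by decide),
    pderiv_X_of_ne (show (3 : Fin 5) ≠ 0 by decide), pderiv_X_of_ne (show (4 : Fin 5) ≠ 0 by decide)]
  norm_num
  ring

/-- `∂₁ g = 6X₁(X₁² + X₀³)²`. [folklore] -/
theorem pderiv_one_t4 {A : Type*} [CommRing A] :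
    pderiv 1 (X 2 ^ 2 + (X 1 ^ 2 + X 0 ^ 3) ^ 3 + X 3 ^ 7 + X 4 ^ 8 + X 0 ^ 12 : MvPolynomial (Fin 5) A) =
      6 * X 1 * (X 1 ^ 2 + X 0 ^ 3) ^ 2 := by
  simp only [map_add, pderiv_pow, pderiv_X_self,
    pderiv_X_of_ne (show (0 : Fin 5) ≠ 1 by decide), pderiv_X_of_ne (show (2 : Fin 5) ≠ 1 by decide),
    pderiv_X_of_ne (show (3 : Fin 5) ≠ 1 by decide), pderiv_X_of_ne (show (4 : Fin 5) ≠ 1 by decide)]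
  norm_num
  ring

/-- `∂₂ g = 2X₂`. [folklore] -/
theorem pderiv_two_t4 {A : Type*} [CommRing A] :
    pderiv 2 (X 2 ^ 2 + (X 1 ^ 2 + X 0 ^ 3) ^ 3 + X 3 ^ 7 + X 4 ^ 8 + X 0 ^ 12 : MvPolynomial (Fin 5) A) = 2 * X 2 := by
  simp only [map_add, pderiv_pow, pderiv_X_self,
    pderiv_X_of_ne (show (0 : Fin 5) ≠ 2 by decide), pderiv_X_of_ne (show (1 : Fin 5) ≠ 2 by decide),
    pderiv_X_of_ne (show (3 : Fin 5) ≠ 2 by decide), pderiv_X_of_ne (show (4 : Fin 5) ≠ 2 by decide)]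
  norm_num

/-- `∂₃ g = 7X₃⁶` (`= 0` in characteristic `7`). [folklore] -/
theorem pderiv_three_t4 {A : Type*} [CommRing A] :
    pderiv 3 (X 2 ^ 2 + (X 1 ^ 2 + X 0 ^ 3) ^ 3 + X 3 ^ 7 + X 4 ^ 8 + X 0 ^ 12 : MvPolynomial (Fin 5) A) = 7 * X 3 ^ 6 := by
  simp only [map_add, pderiv_pow, pderiv_X_self,
    pderiv_X_of_ne (show (0 : Fin 5) ≠ 3 by decide), pderiv_X_of_ne (show (1 : Fin 5) ≠ 3 by decide),
    pderiv_X_of_ne (show (2 : Fin 5) ≠ 3 by decide), pderiv_X_of_ne (show (4 : Fin 5) ≠ 3 by decide)]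
  norm_num

/-- `∂₄ g = 8X₄⁷`. [folklore] -/
theorem pderiv_four_t4 {A : Type*} [CommRing A] :
    pderiv 4 (X 2 ^ 2 + (X 1 ^ 2 + X 0 ^ 3) ^ 3 + X 3 ^ 7 + X 4 ^ 8 + X 0 ^ 12 : MvPolynomial (Fin 5) A) = 8 * X 4 ^ 7 := by
  simp only [map_add, pderiv_pow, pderiv_X_self,
    pderiv_X_of_ne (show (0 : Fin 5) ≠ 4 by decide), pderiv_X_of_ne (show (1 : Fin 5) ≠ 4 by decide),
    pderiv_X_of_ne (show (2 : Fin 5) ≠ 4 by decide), pderiv_X_of_ne (show (3 : Fin 5) ≠ 4 by decide)]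
  norm_num

/-! ## §2 The Jacobian at the primes strictly inside the origin (characteristic `7`) -/

/-- Constants `n` with `7 ∤ n` are units of `k[X]` in characteristic `7`, so may be cancelled from ideal membership.
[plumbing] -/
theorem mem_of_natCast_mul_mem (k : Type) [Field k] [CharP k 7] (P : Ideal (MvPolynomial (Fin 5) k)) (n : ℕ) (hn : ¬ 7 ∣ n)
    (q : MvPolynomial (Fin 5) k) (h : (n : MvPolynomial (Fin 5) k) * q ∈ P) : q ∈ P := by
  have hk : (n : k) ≠ 0 := fun h0 => hn ((CharP.cast_eq_zero_iff k 7 n).mp h0)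
  have hu : IsUnit (n : MvPolynomial (Fin 5) k) := by
    rw [← map_natCast (C : k →+* MvPolynomial (Fin 5) k) n]
    exact (IsUnit.mk0 _ hk).map C
  exact (Ideal.unit_mul_mem_iff_mem P hu).mp h

/-- **The T⁽⁴⁾ germ at the origin is an isolated singularity in characteristic `7` (Jacobian form).** For a prime `P` of
`k[X₀,…,X₄]` containing `g = X₂² + (X₁² + X₀³)³ + X₃⁷ + X₄⁸ + X₀¹²`, contained in the origin `(X₀,…,X₄)` (every member has
constant coefficient `0`) and different from it (some `Xᵢ ∉ P`), some partial derivative `∂ᵢ g ∉ P`. Proof: if all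
`∂ᵢ g ∈ P` then `X₂ ∈ P` (`∂₂ = 2X₂`), `X₄ ∈ P` (`∂₄ = 8X₄⁷`), and `X₁ ∈ P` or `u := X₁² + X₀³ ∈ P` (`∂₁ = 6X₁u²`); if `u ∈ P`
then `∂₀ = 9X₀²u² + 12X₀¹¹` gives `X₀ ∈ P`, hence `X₁ ∈ P`, and `g ∈ P` gives `X₃ ∈ P` — so `P` is the origin; if `X₁ ∈ P ∌ u`
then `X₀ ∉ P` and `∂₀ ≡ X₀⁸(9 + 12X₀³)` modulo `P`, so `9 + 12X₀³ ∈ P`, whose constant coefficient `9 = 2 ≠ 0` — contradiction.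
[folklore; cite: Hartshorne1977, I Thm. 5.1 (Jacobian criterion)] -/
theorem exists_pderiv_not_mem (k : Type) [Field k] [CharP k 7] (g : MvPolynomial (Fin 5) k)
    (hg : g = X 2 ^ 2 + (X 1 ^ 2 + X 0 ^ 3) ^ 3 + X 3 ^ 7 + X 4 ^ 8 + X 0 ^ 12)
    (P : Ideal (MvPolynomial (Fin 5) k)) [hP : P.IsPrime] (hgP : g ∈ P)
    (hP0 : ∀ q ∈ P, constantCoeff q = 0) (hne : ∃ i : Fin 5, (X i : MvPolynomial (Fin 5) k) ∉ P) :
    ∃ i : Fin 5, pderiv i g ∉ P := by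
  by_contra hall
  push Not at hall
  subst hg
  have hc : ∀ n : ℕ, ¬ 7 ∣ n → ∀ q : MvPolynomial (Fin 5) k, (n : MvPolynomial (Fin 5) k) * q ∈ P → q ∈ P :=
    fun n hn q h => mem_of_natCast_mul_mem k P n hn q h
  -- `X₂ ∈ P`
  have hX2 : (X 2 : MvPolynomial (Fin 5) k) ∈ P := by
    have h := hall 2
    rw [pderiv_two_t4] at h
    exact hc 2 (by norm_num) _ (by exact_mod_cast h)
  -- `X₄ ∈ P`
  have hX4 : (X 4 : MvPolynomial (Fin 5) k) ∈ P := by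
    have h := hall 4
    rw [pderiv_four_t4] at h
    exact hP.mem_of_pow_mem 7 (hc 8 (by norm_num) _ (by exact_mod_cast h))
  -- `∂₀ ∈ P`
  have h0 : (9 * X 0 ^ 2 * (X 1 ^ 2 + X 0 ^ 3) ^ 2 + 12 * X 0 ^ 11 : MvPolynomial (Fin 5) k) ∈ P := by
    have h := hall 0
    rwa [pderiv_zero_t4] at h
  -- case A: `u ∈ P` forces `P` to be the origin
  have caseA : (X 1 ^ 2 + X 0 ^ 3 : MvPolynomial (Fin 5) k) ∈ P → False := by
    intro hu
    have hX0 : (X 0 : MvPolynomial (Fin 5) k) ∈ P := by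
      have h9 : (9 * X 0 ^ 2 * (X 1 ^ 2 + X 0 ^ 3) ^ 2 : MvPolynomial (Fin 5) k) ∈ P :=
        P.mul_mem_left _ (P.pow_mem_of_mem hu 2 (by norm_num))
      have h12 : (12 * X 0 ^ 11 : MvPolynomial (Fin 5) k) ∈ P := by
        have := P.sub_mem h0 h9
        rwa [add_sub_cancel_left] at this
      exact hP.mem_of_pow_mem 11 (hc 12 (by norm_num) _ (by exact_mod_cast h12))
    have hX1 : (X 1 : MvPolynomial (Fin 5) k) ∈ P := by
      have : (X 1 ^ 2 : MvPolynomial (Fin 5) k) ∈ P := by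
        have := P.sub_mem hu (P.pow_mem_of_mem hX0 3 (by norm_num))
        rwa [add_sub_cancel_right] at this
      exact hP.mem_of_pow_mem 2 this
    have hX3 : (X 3 : MvPolynomial (Fin 5) k) ∈ P := by
      have h37 : (X 3 ^ 7 : MvPolynomial (Fin 5) k) ∈ P := by
        have hrest : (X 2 ^ 2 + (X 1 ^ 2 + X 0 ^ 3) ^ 3 + X 4 ^ 8 + X 0 ^ 12 : MvPolynomial (Fin 5) k) ∈ P :=
          P.add_mem (P.add_mem (P.add_mem (P.pow_mem_of_mem hX2 2 (by norm_num)) (P.pow_mem_of_mem hu 3 (by norm_num)))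
            (P.pow_mem_of_mem hX4 8 (by norm_num))) (P.pow_mem_of_mem hX0 12 (by norm_num))
        have := P.sub_mem hgP hrest
        have e : (X 2 ^ 2 + (X 1 ^ 2 + X 0 ^ 3) ^ 3 + X 3 ^ 7 + X 4 ^ 8 + X 0 ^ 12 : MvPolynomial (Fin 5) k) -
            (X 2 ^ 2 + (X 1 ^ 2 + X 0 ^ 3) ^ 3 + X 4 ^ 8 + X 0 ^ 12) = X 3 ^ 7 := by ring
        rwa [e] at this
      exact hP.mem_of_pow_mem 7 h37
    obtain ⟨i, hi⟩ := hne
    fin_cases i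
    · exact hi hX0
    · exact hi hX1
    · exact hi hX2
    · exact hi hX3
    · exact hi hX4
  -- `X₁ ∈ P` or `u ∈ P`
  have h1 : (X 1 : MvPolynomial (Fin 5) k) ∈ P ∨ (X 1 ^ 2 + X 0 ^ 3 : MvPolynomial (Fin 5) k) ∈ P := by
    have h := hall 1
    rw [pderiv_one_t4] at h
    have h' : (X 1 * (X 1 ^ 2 + X 0 ^ 3) ^ 2 : MvPolynomial (Fin 5) k) ∈ P := by
      refine hc 6 (by norm_num) _ ?_
      have e : ((6 : ℕ) : MvPolynomial (Fin 5) k) * (X 1 * (X 1 ^ 2 + X 0 ^ 3) ^ 2) = 6 * X 1 * (X 1 ^ 2 + X 0 ^ 3) ^ 2 := by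
        push_cast; ring
      rwa [e]
    rcases hP.mem_or_mem h' with h1 | h2
    · exact Or.inl h1
    · exact Or.inr (hP.mem_of_pow_mem 2 h2)
  rcases h1 with hX1 | hu
  · -- case B: `X₁ ∈ P`
    by_cases hu : (X 1 ^ 2 + X 0 ^ 3 : MvPolynomial (Fin 5) k) ∈ P
    · exact caseA hu
    have hX0 : (X 0 : MvPolynomial (Fin 5) k) ∉ P := fun hX0 =>
      hu (P.add_mem (P.pow_mem_of_mem hX1 2 (by norm_num)) (P.pow_mem_of_mem hX0 3 (by norm_num)))
    -- `∂₀ ≡ X₀⁸ (9 + 12 X₀³)` modulo `(X₁)`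
    have hkey : (X 0 ^ 8 * (9 + 12 * X 0 ^ 3) : MvPolynomial (Fin 5) k) ∈ P := by
      have hjunk : (9 * X 0 ^ 2 * X 1 ^ 2 * (X 1 ^ 2 + 2 * X 0 ^ 3) : MvPolynomial (Fin 5) k) ∈ P :=
        P.mul_mem_right _ (P.mul_mem_left _ (P.pow_mem_of_mem hX1 2 (by norm_num)))
      have := P.sub_mem h0 hjunk
      have e : (9 * X 0 ^ 2 * (X 1 ^ 2 + X 0 ^ 3) ^ 2 + 12 * X 0 ^ 11 : MvPolynomial (Fin 5) k) -
          9 * X 0 ^ 2 * X 1 ^ 2 * (X 1 ^ 2 + 2 * X 0 ^ 3) = X 0 ^ 8 * (9 + 12 * X 0 ^ 3) := by ring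
      rwa [e] at this
    rcases hP.mem_or_mem hkey with h8 | h9
    · exact hX0 (hP.mem_of_pow_mem 8 h8)
    · have h9c := hP0 _ h9
      have e9 : constantCoeff (9 + 12 * X 0 ^ 3 : MvPolynomial (Fin 5) k) = 9 := by
        rw [map_add, map_mul, map_pow, constantCoeff_X, map_ofNat, map_ofNat]; ring
      rw [e9] at h9c
      -- `(9 : k) = 0` contradicts characteristic 7
      have h97 : ((9 : ℕ) : k) ≠ 0 := fun h0 => by
        have := (CharP.cast_eq_zero_iff k 7 9).mp h0; omega
      exact h97 (by exact_mod_cast h9c)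
  · exact caseA hu

end Summit.ResolutionOfSingularities.ResolutionOfSingularities.Theorems.FInjectiveMacaulayfication.T4GermJacobianChar7

end
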